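import Literature.NumberTheory.Automorphic.LevelActionCoefficientChange
import Mathlib.LinearAlgebra.PiTensorProduct.Basic
import HarnessLib

/-!
# Independence of weight is compatible with tensor products of coefficient modules

Topic `NumberTheory/Automorphic`; namespace `Literature.NumberTheory.Automorphic.LevelAction`;
one definition with a body and theorems.  A complement to `LevelActionCoefficientChange` (the
GENERIC half of independence of weight, [KhareThorne2017, §6.4, Prop. 6.13]; [Hida1994AIF, §2,
Prop. 2.1]) for coefficient modules that are TENSOR PRODUCTS `⨂_j V_j` — the case of
`Res_{F/ℚ} GL_n` ([KhareThorne2017, §6.4]: `M_𝛌 = ⊗_τ M_{λ_τ}`; for an imaginary quadratic `F` the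
two factors indexed by the embeddings `τ, τ̄ : F → ℚ̄_p`):

* `tensorAction τ : Δ →* End(⨂_j V_j)`, `δ ↦ ⊗_j τ_j(δ)` (Mathlib `PiTensorProduct.mapMonoidHom`);
* the three hypotheses of `LevelActionCoefficientChange` pass to tensor products factorwise:
  equivariance of `φ = ⊗_j φ_j` (`tensor_equivariant`), the splitting `φ ∘ ψ = id` for `ψ = ⊗_j ψ_j`
  (`tensor_split`) and the factorisation `τ(y) ∘ ψ ∘ φ = τ(y)` along a double coset
  (`tensor_heckeFactorsThrough`; a factor on which the weight is NOT changed takes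
  `φ_j = ψ_j = id`, `heckeFactorsThrough_id`).

Hence (`LevelActionCoefficientChange.raise`, `…raiseCohomology_comp_pushforwardCohomology`)
independence of weight one place `v ∣ p` at a time for `⨂_τ Sym^{m_τ}`, changing the weight at the
factors `τ` above `v`.

## References

* C. Khare, J. A. Thorne, Amer. J. Math. 139 (2017), §6.4, Prop. 6.13 (arXiv:1409.7007, held).
  [KhareThorne2017]
* H. Hida, Ann. Inst. Fourier 44 (1994), §2, Prop. 2.1 (held). [Hida1994AIF]
-/

noncomputable section

open scoped TensorProduct
open PiTensorProduct

universe u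

namespace Literature.NumberTheory.Automorphic.LevelAction

variable {R : Type u} [CommRing R] {𝒢 : Type u} [Group 𝒢] (Δ : Submonoid 𝒢) (U : Subgroup 𝒢)
  {J : Type u} {V V' : J → Type u} [∀ j, AddCommGroup (V j)] [∀ j, Module R (V j)]
  [∀ j, AddCommGroup (V' j)] [∀ j, Module R (V' j)]
  (τ : ∀ j, Δ →* Module.End R (V j)) (τ' : ∀ j, Δ →* Module.End R (V' j))

/-- **The tensor product action `δ ↦ ⊗_j τ_j(δ)` of `Δ` on `⨂_j V_j`.** [cite: KhareThorne2017, §6.4] -/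
def tensorAction : Δ →* Module.End R (⨂[R] j, V j) :=
  PiTensorProduct.mapMonoidHom.comp (MonoidHom.pi τ)

/-- `tensorAction` on pure tensors. [folklore] -/
@[simp]
theorem tensorAction_apply_tprod (δ : Δ) (v : ∀ j, V j) :
    tensorAction Δ τ δ (tprod R v) = tprod R fun j => τ j δ (v j) := by
  rw [tensorAction, MonoidHom.comp_apply, mapMonoidHom_apply, map_tprod]
  rfl

/-- `tensorAction δ = PiTensorProduct.map (τ · δ)`. [folklore] -/
theorem tensorAction_apply (δ : Δ) : tensorAction Δ τ δ = map fun j => τ j δ :=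
  rfl

variable (φ : ∀ j, V j →ₗ[R] V' j) (ψ : ∀ j, V' j →ₗ[R] V j)

/-- **Equivariance passes to `⊗_j φ_j`.** [folklore] -/
theorem tensor_equivariant (hφ : ∀ j (δ : Δ), φ j ∘ₗ τ j δ = τ' j δ ∘ₗ φ j) (δ : Δ) :
    map φ ∘ₗ tensorAction Δ τ δ = tensorAction Δ τ' δ ∘ₗ map φ := by
  rw [tensorAction_apply, tensorAction_apply, ← map_comp, ← map_comp]
  exact congrArg _ (funext fun j => hφ j δ)

/-- **The splitting `φ ∘ ψ = id` passes to tensor products.** [folklore] -/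
theorem tensor_split (hsplit : ∀ j, φ j ∘ₗ ψ j = LinearMap.id) : map φ ∘ₗ map ψ = LinearMap.id := by
  rw [← map_comp, ← map_id]
  exact congrArg _ (funext fun j => hsplit j)

/-- **The factorisation `τ(y) ∘ ψ ∘ φ = τ(y)` passes to tensor products.** [folklore] -/
theorem tensor_factorsThrough (y : Δ) (hfac : ∀ j, τ j y ∘ₗ (ψ j ∘ₗ φ j) = τ j y) :
    tensorAction Δ τ y ∘ₗ (map ψ ∘ₗ map φ) = tensorAction Δ τ y := by
  rw [tensorAction_apply, ← map_comp, ← map_comp]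
  exact congrArg _ (funext fun j => hfac j)

/-- **`HeckeFactorsThrough` along `U α U` passes to tensor products.**
[cite: KhareThorne2017, §6.4, proof of Prop. 6.13] -/
theorem tensor_heckeFactorsThrough (α : 𝒢)
    (hfac : ∀ j, HeckeFactorsThrough Δ (τ j) U (φ j) (ψ j) α) :
    HeckeFactorsThrough Δ (tensorAction Δ τ) U (map φ) (map ψ) α := fun y hy hyα =>
  tensor_factorsThrough Δ τ φ ψ ⟨y, hy⟩ fun j => hfac j y hy hyα

omit [∀ j, AddCommGroup (V' j)] [∀ j, Module R (V' j)] in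
/-- A factor on which the weight is not changed: `φ = ψ = id` factors trivially. [folklore] -/
theorem heckeFactorsThrough_id (j : J) (α : 𝒢) :
    HeckeFactorsThrough Δ (τ j) U (LinearMap.id : V j →ₗ[R] V j) LinearMap.id α := fun _ _ _ => by
  rw [LinearMap.id_comp, LinearMap.comp_id]

omit [∀ j, AddCommGroup (V' j)] [∀ j, Module R (V' j)] in
/-- A factor on which the weight is not changed is equivariant for `φ = id`. [folklore] -/
theorem id_equivariant (j : J) (δ : Δ) :
    (LinearMap.id : V j →ₗ[R] V j) ∘ₗ τ j δ = τ j δ ∘ₗ LinearMap.id := by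
  rw [LinearMap.id_comp, LinearMap.comp_id]

end Literature.NumberTheory.Automorphic.LevelAction
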